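import Summits.PneNP.PneNP.Theses.AeaCutRectangles

/-!
# Sketch — crux-ideate r2s2g18 on `FoolingMeasure` (stmt-PneNP-19727)

First-lemma signatures for the card `lindsey-outsourcing` (planted bilinear lightness).
Nothing here is proved except the elementary label-rectangle step; `LindseyRect` is the
classical character-sum bound (Lindsey / Chor–Goldreich) stated as a named Prop.
-/

namespace Summit.PneNP.PneNP.Cruxes.FoolingMeasure.IdeasR2s2g18

open Finset

/-- Alice side of an edge set at Bob-set `B`: every edge meets `A = Bᶜ` (as in the route file). -/
def IsAliceSide {n : ℕ} (B : Finset (Fin n)) (α : Finset (Sym2 (Fin n))) : Prop :=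
  ∀ e ∈ α, ¬ e.IsDiag ∧ ∃ v ∈ e, v ∉ B

/-- Bob side: every edge inside `B`. -/
def IsBobSide {n : ℕ} (B : Finset (Fin n)) (β : Finset (Sym2 (Fin n))) : Prop :=
  ∀ e ∈ β, ¬ e.IsDiag ∧ ∀ v ∈ e, v ∈ B

/-- The hybrid `α ∪ β` is 3-colourable ("light pair"). -/
def Light {n : ℕ} (α β : Finset (Sym2 (Fin n))) : Prop :=
  (SimpleGraph.fromEdgeSet ((α ∪ β : Finset (Sym2 (Fin n))) : Set (Sym2 (Fin n)))).Colorable 3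

/-- Standard bilinear form on `(ZMod p)^k`. -/
def ip {p k : ℕ} (s t : Fin k → ZMod p) : ZMod p := ∑ i, s i * t i

/-- LINDSEY / CHOR–GOLDREICH rectangle bound (classical; `[corpus:jukna2012 p.584]` for the
Hadamard form): two subsets of `(ZMod p)^k` with no orthogonal pair across them satisfy
`|S|·|T| ≤ (p-1)²·p^k`.  Named fact, to be proved in Theorems (character sums + Parseval). -/
def LindseyRect (p k : ℕ) : Prop :=
  p.Prime → ∀ S T : Finset (Fin k → ZMod p),
    (∀ s ∈ S, ∀ t ∈ T, ip s t ≠ 0) → S.card * T.card ≤ (p - 1) ^ 2 * p ^ k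

/-- PLANTED BILINEAR LIGHTNESS at cut `B` for a family `M` of member graphs (the support):
labels `φ` (read off Alice sides) and `ψ` (read off Bob sides) such that an orthogonal label pair
forces the hybrid to be 3-colourable.  Quantified over sides OF MEMBERS only (the rectangle
argument never needs other rows/columns). -/
def BilinearLightness {n : ℕ} (p k : ℕ) (B : Finset (Fin n))
    (M : Finset (Finset (Sym2 (Fin n))))
    (aliceOf bobOf : Finset (Sym2 (Fin n)) → Finset (Sym2 (Fin n)))
    (φ ψ : Finset (Sym2 (Fin n)) → (Fin k → ZMod p)) : Prop :=
  ∀ G ∈ M, ∀ G' ∈ M, ip (φ (aliceOf G)) (ψ (bobOf G')) = 0 → Light (aliceOf G) (bobOf G')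

/-- FIRST LEMMA (size S, provable now): under planted bilinear lightness, the label images of a
dark rectangle avoid orthogonality, hence obey the Lindsey bound.  Together with near-flatness of
the label distributions (min-entropy ≥ k·log₂ p − D on each side) this bounds every dark
rectangle's mass by `(p-1)·p^{k/2}·2^{D}·p^{-k}`-type quantities, i.e. by `δ = n^{-n/2}2^{-Cn}` as
soon as `(k-2)·log₂ p ≥ n·log₂ n + 2Cn + 2D`. -/
def LabelRectBound {n : ℕ} (p k : ℕ) (B : Finset (Fin n))
    (M : Finset (Finset (Sym2 (Fin n))))
    (aliceOf bobOf : Finset (Sym2 (Fin n)) → Finset (Sym2 (Fin n)))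
    (φ ψ : Finset (Sym2 (Fin n)) → (Fin k → ZMod p)) : Prop :=
  LindseyRect p k → p.Prime → BilinearLightness p k B M aliceOf bobOf φ ψ →
    ∀ 𝓐 𝓑 : Finset (Finset (Sym2 (Fin n))),
      (∀ α ∈ 𝓐, ∀ β ∈ 𝓑, ¬ Light α β) →
      ((M.filter fun G => aliceOf G ∈ 𝓐).image fun G => φ (aliceOf G)).card *
        ((M.filter fun G => bobOf G ∈ 𝓑).image fun G => ψ (bobOf G)).card
        ≤ (p - 1) ^ 2 * p ^ k

/-- The first lemma holds (the images avoid orthogonality by `BilinearLightness` + darkness). -/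
theorem labelRectBound_holds {n : ℕ} (p k : ℕ) (B : Finset (Fin n))
    (M : Finset (Finset (Sym2 (Fin n))))
    (aliceOf bobOf : Finset (Sym2 (Fin n)) → Finset (Sym2 (Fin n)))
    (φ ψ : Finset (Sym2 (Fin n)) → (Fin k → ZMod p)) :
    LabelRectBound p k B M aliceOf bobOf φ ψ := by
  intro hL hp hBL 𝓐 𝓑 hdark
  refine hL hp _ _ ?_
  intro s hs t ht
  simp only [mem_image, mem_filter] at hs ht
  obtain ⟨G, ⟨hG, hGA⟩, rfl⟩ := hs
  obtain ⟨G', ⟨hG', hGB⟩, rfl⟩ := ht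
  intro h0
  exact hdark _ hGA _ hGB (hBL G hG G' hG' h0)

/-- TRANSFER TARGET C⁺ (informal numerics in the docstring of `LabelRectBound`): a Hadamard species
at size `n` with purse constant `C` — a support `M` of non-3-colourable graphs with a measure, and for
EVERY near-balanced `B` labels `(φ_B, ψ_B)` into `(ZMod p)^k`, `k ≥ 3`, with planted bilinear
lightness and near-flat label laws.  Stated here only as the per-cut combinatorial core. -/
def HadamardCut {n : ℕ} (p k : ℕ) (B : Finset (Fin n)) (M : Finset (Finset (Sym2 (Fin n))))
    (φ ψ : Finset (Sym2 (Fin n)) → (Fin k → ZMod p)) : Prop :=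
  BilinearLightness p k B M
    (fun G => G.filter fun e => ∃ v ∈ e, v ∉ B) (fun G => G.filter fun e => ∀ v ∈ e, v ∈ B) φ ψ

end Summit.PneNP.PneNP.Cruxes.FoolingMeasure.IdeasR2s2g18
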